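import Summits.ABC.ABC.Theses.DefiniteXi
import Literature.NumberTheory.EllipticCurves.LFunctionPrimeCoeff
import Literature.NumberTheory.EllipticCurves.SzpiroFreyProofs
import Literature.NumberTheory.EllipticCurves.OrdinaryPrimesProofs
import Literature.NumberTheory.DiophantineGeometry.LocalReductionFiniteBadPlacesProofs
import HarnessLib

/-!
# The Frey form is Eisenstein mod `4` (stub `stub_freyEisensteinModFour` of line
`two-adic-redei-depth`, crux `XiBound`, stmt-ABC-11336)

For coprime `a, b` with `ab(a+b) ≠ 0` and an odd prime `p ∤ ab(a+b)`,
`4 ∣ p + 1 − a_p(E_(a,b))`, where `a_p` is the `p`-th coefficient of Mathlib's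
`WeierstrassCurve.LFunction` of the Frey–Hellegouarch curve `freyCurve a b : y² = x(x − a)(x + b)`.

Proof. Let `v` be the place of `ℚ` over `p`, `𝓞_v ⊂ ℚ_v` its completed integers. The Frey model
is a `ℤ`-model (`freyIntModel`), so it is `v`-integral, and its discriminant `16 (ab(a+b))²` is a
`v`-unit; hence it is minimal at `v` with good reduction, and the `p`-th coefficient of `L(E, s)` is
`p + 1 − #Ẽ(κ(v))` for the reduction `Ẽ` of Mathlib's chosen `𝓞_v`-minimal model
(`LFunction_apply_prime`, `coeff_one_localPowerSeries_of_hasGoodReduction`), which has as many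
points as the reduction of the Frey model itself (`natCard_point_reduction_minimal`, Silverman
VII.1.3(b)). The latter is `y² = x(x − ā)(x + b̄)` over `κ(v) ≃ ℤ/p`, on which `O, (0,0), (ā,0)`
are distinct (`ā ≠ 0`) with `(0,0), (ā,0)` of order `2` (`a₁ = a₃ = 0`, `y = 0`), nonsingular
because `ā b̄ ≠ 0` and `ā (ā + b̄) ≠ 0`; two distinct nonzero elements of order `2` span a Klein
four subgroup, so `4 ∣ #Ẽ(ℤ/p)` by Lagrange (the tree's
`WeierstrassCurve.four_dvd_natCard_of_two_torsion`, for `Nat.card`, no finiteness needed).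
-/

-- `Summit.<Summit>.<Problem>`: for the single-conjunct summit `ABC` the duplicate `ABC.ABC` is mandated.
set_option linter.dupNamespace false

noncomputable section

namespace Summit.ABC.ABC.Theorems

namespace XiBoundFreyEisenstein

open IsDedekindDomain NumberField WeierstrassCurve Rat.HeightOneSpectrum
open Literature.NumberTheory.EllipticCurves

/-! ### The curve `y² = x (x − a) (x + b)` over a field has `4 ∣ #E(F)` -/

/-- On `y² = x(x − a)(x + b)` (`a₁ = a₃ = a₆ = 0`, `a₂ = b − a`, `a₄ = −ab`) over a field with
`a, b, a + b ≠ 0`, the points `(0, 0)` and `(a, 0)` are nonsingular, distinct, and of order `2`,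
so `4 ∣ Nat.card E(F)` (`WeierstrassCurve.four_dvd_natCard_of_two_torsion`). No hypothesis on the
characteristic is needed. -/
theorem four_dvd_natCard_point {F : Type*} [Field F] {W : WeierstrassCurve F} {a b : F}
    (h₁ : W.a₁ = 0) (h₂ : W.a₂ = b - a) (h₃ : W.a₃ = 0) (h₄ : W.a₄ = -(a * b)) (h₆ : W.a₆ = 0)
    (ha : a ≠ 0) (hb : b ≠ 0) (hab : a + b ≠ 0) : 4 ∣ Nat.card W.toAffine.Point := by
  classical
  have hns : ∀ x : F, x * (x - a) * (x + b) = 0 → 3 * x ^ 2 + 2 * (b - a) * x - a * b ≠ 0 →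
      W.toAffine.Nonsingular x 0 := fun x hx hx' ↦ by
    rw [Affine.nonsingular_iff']
    refine ⟨?_, Or.inl ?_⟩
    · rw [Affine.equation_iff]
      simp only [toAffine, h₁, h₂, h₃, h₄, h₆]
      linear_combination -hx
    · simp only [toAffine, h₁, h₂, h₄]
      intro h
      apply hx'
      linear_combination -h
  have hO : W.toAffine.Nonsingular 0 0 :=
    hns 0 (by ring) (fun h ↦ mul_ne_zero ha hb (by linear_combination -h))
  have hA : W.toAffine.Nonsingular a 0 :=
    hns a (by ring) (fun h ↦ mul_ne_zero ha hab (by linear_combination h))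
  have hneg : ∀ x : F, (0 : F) = W.toAffine.negY x 0 := fun x ↦ by
    simp [Affine.negY, toAffine, h₁, h₃]
  refine four_dvd_natCard_of_two_torsion (P := .some 0 0 hO) (Q := .some a 0 hA)
    (Affine.Point.some_ne_zero hO) (Affine.Point.some_ne_zero hA) ?_
    (Affine.Point.add_self_of_Y_eq (hneg 0)) (Affine.Point.add_self_of_Y_eq (hneg a))
  intro h
  injection h with hx
  exact ha hx.symm

/-- `4 ∣ #E(F)` for the reduction-type curve `freyIntModel a b ⊗ F` along any `f : ℤ →+* F`
with `f a, f b, f (a + b) ≠ 0`. -/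
theorem four_dvd_natCard_point_freyIntModel_map {F : Type*} [Field F] (f : ℤ →+* F) {a b : ℤ}
    (ha : f a ≠ 0) (hb : f b ≠ 0) (hab : f (a + b) ≠ 0) :
    4 ∣ Nat.card ((freyIntModel a b).map f).toAffine.Point :=
  four_dvd_natCard_point (W := (freyIntModel a b).map f) (a := f a) (b := f b)
    (by simp [freyIntModel]) (by simp [freyIntModel]) (by simp [freyIntModel])
    (by simp [freyIntModel]) (by simp [freyIntModel]) ha hb (by rwa [← map_add])

/-! ### The place `v` of `ℚ` over an odd prime `p ∤ ab(a+b)` -/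

/-- Valuation of an integer at a finite place of `ℚ`: it is `1` iff the prime under `v` does not
divide it. -/
theorem valuation_intCast_eq_one_iff (v : HeightOneSpectrum (𝓞 ℚ)) (m : ℤ) :
    v.valuation ℚ (m : ℚ) = 1 ↔ ¬ ((primesEquiv v : ℕ) : ℤ) ∣ m := by
  haveI : Fact (primesEquiv v : ℕ).Prime := ⟨(primesEquiv v).2⟩
  rw [(valuation_equiv_padicValuation v).eq_one_iff_eq_one, Rat.padicValuation_cast,
    Int.padicValuation_eq_one_iff]

/-- For `v` over an odd prime `p ∤ ab(a+b)`, the discriminant `16 (ab(a+b))²` of the Frey model is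
a `v`-unit. -/
theorem valuation_Δ_freyCurve_eq_one {a b : ℤ} (v : HeightOneSpectrum (𝓞 ℚ))
    (hv2 : (primesEquiv v : ℕ) ≠ 2) (hdiv : ¬ ((primesEquiv v : ℕ) : ℤ) ∣ a * b * (a + b)) :
    v.valuation ℚ (freyCurve a b).Δ = 1 := by
  have hΔ : (freyCurve a b).Δ = ((16 * (a * b * (a + b)) ^ 2 : ℤ) : ℚ) := by
    rw [freyCurve_Δ]; push_cast; ring
  rw [hΔ, valuation_intCast_eq_one_iff]
  intro h
  have hp : Prime ((primesEquiv v : ℕ) : ℤ) := Nat.prime_iff_prime_int.mp (primesEquiv v).2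
  rcases hp.dvd_or_dvd h with h16 | h2
  · have h2' : ((primesEquiv v : ℕ) : ℤ) ∣ 2 ^ 4 := by norm_num; exact h16
    have h2'' : (primesEquiv v : ℕ) ∣ 2 := by exact_mod_cast hp.dvd_of_dvd_pow h2'
    exact hv2 ((Nat.prime_dvd_prime_iff_eq (primesEquiv v).2 Nat.prime_two).mp h2'')
  · exact hdiv (hp.dvd_of_dvd_pow h2)

/-- `(freyIntModel a b) ⊗ 𝓞_v` is an `𝓞_v`-model of the Frey curve over `ℚ_v` (the Frey model is
the `ℤ`-model `freyIntModel a b`, B–G (12.17), base-changed to `ℚ`). -/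
theorem baseChange_freyIntModel_map (a b : ℤ) (v : HeightOneSpectrum (𝓞 ℚ)) :
    ((freyIntModel a b).map (algebraMap ℤ (v.adicCompletionIntegers ℚ))).baseChange
        (v.adicCompletion ℚ) = (freyCurve a b).baseChange (v.adicCompletion ℚ) := by
  rw [← baseChange_freyIntModel, baseChange, baseChange, baseChange, map_map, map_map]
  congr 1
  exact Subsingleton.elim _ _

/-- The Frey model is integral over `𝓞_v` after base change to `ℚ_v`. -/
theorem isIntegral_baseChange_freyCurve (a b : ℤ) (v : HeightOneSpectrum (𝓞 ℚ)) :
    ((freyCurve a b).baseChange (v.adicCompletion ℚ)).IsIntegral (v.adicCompletionIntegers ℚ) :=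
  ⟨_, (baseChange_freyIntModel_map a b v).symm⟩

/-- **The local computation.** For the place `v` of `ℚ` over an odd prime `p ∤ ab(a+b)`:
`4 ∣ p + 1 − a_p(E_(a,b))`, `a_p` the `p`-th coefficient of `WeierstrassCurve.LFunction`. -/
theorem four_dvd_prime_add_one_sub_lFunction (a b : ℤ) (v : HeightOneSpectrum (𝓞 ℚ))
    (hv2 : (primesEquiv v : ℕ) ≠ 2) (hdiv : ¬ ((primesEquiv v : ℕ) : ℤ) ∣ a * b * (a + b)) :
    (4 : ℤ) ∣ ((primesEquiv v : ℕ) : ℤ) + 1 - (freyCurve a b).LFunction (primesEquiv v) := by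
  haveI := Fact.mk (primesEquiv v).2
  have h0 : a * b * (a + b) ≠ 0 := fun h ↦ hdiv (h ▸ dvd_zero _)
  haveI := isElliptic_freyCurve h0
  have hΔ1 := valuation_Δ_freyCurve_eq_one v hv2 hdiv
  haveI hint := isIntegral_baseChange_freyCurve a b v
  have hgood : (freyCurve a b).HasGoodReductionAt v :=
    hasGoodReductionAt_of_valuation_Δ_eq_one_holds v _ hint hΔ1
  haveI hmin : IsMinimal (v.adicCompletionIntegers ℚ)
      ((freyCurve a b).baseChange (v.adicCompletion ℚ)) :=
    isMinimal_of_valuation_Δ_eq_one _ (by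
      rw [baseChange, map_Δ]
      exact valuation_maximalIdeal_adicCompletion_eq_one hΔ1)
  have hΔX : ((freyCurve a b).baseChange (v.adicCompletion ℚ)).Δ ≠ 0 := by
    rw [baseChange, map_Δ]
    exact (map_ne_zero _).mpr (freyCurve a b).isUnit_Δ.ne_zero
  -- the prime under `v` does not divide `a`, `b`, `a + b`
  have hpa : ¬ ((primesEquiv v : ℕ) : ℤ) ∣ a := fun h ↦
    hdiv (dvd_mul_of_dvd_left (dvd_mul_of_dvd_left h b) _)
  have hpb : ¬ ((primesEquiv v : ℕ) : ℤ) ∣ b := fun h ↦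
    hdiv (dvd_mul_of_dvd_left (dvd_mul_of_dvd_right h a) _)
  have hpab : ¬ ((primesEquiv v : ℕ) : ℤ) ∣ a + b := fun h ↦ hdiv (dvd_mul_of_dvd_right h _)
  -- `4 ∣ #Ẽ(κ(v))` for the reduction of the Frey model
  have h4 : 4 ∣ Nat.card (((freyCurve a b).baseChange (v.adicCompletion ℚ)).reduction
      (v.adicCompletionIntegers ℚ)).toAffine.Point := by
    rw [reduction, integralModel_eq_of_baseChange_eq _ _ (baseChange_freyIntModel_map a b v),
      map_map, ← natCard_point_map_ringEquiv ((IsLocalRing.ResidueField.mapEquiv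
        (adicCompletionIntegers.padicIntEquiv v).toAlgEquiv.toRingEquiv).trans
        (PadicInt.residueField (p := (primesEquiv v : ℕ)))), map_map]
    rw [RingHom.ext_int (RingHom.comp _ _) (Int.castRingHom (ZMod (primesEquiv v : ℕ)))]
    refine four_dvd_natCard_point_freyIntModel_map _ ?_ ?_ ?_
    · rwa [Int.coe_castRingHom, Ne, ZMod.intCast_zmod_eq_zero_iff_dvd]
    · rwa [Int.coe_castRingHom, Ne, ZMod.intCast_zmod_eq_zero_iff_dvd]
    · rwa [Int.coe_castRingHom, Ne, ZMod.intCast_zmod_eq_zero_iff_dvd]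
  rw [(freyCurve a b).LFunction_apply_prime (primesEquiv v).2,
    finsum_eq_single _ v fun w hw ↦ ?_]
  · rw [localEulerFactor_apply_prime _ _ (primesEquiv v).2,
      if_pos (natCard_residueField_adicCompletionIntegers v),
      coeff_one_localPowerSeries_of_hasGoodReduction _ _ hgood,
      natCard_residueField_adicCompletionIntegers, natCard_point_reduction_minimal _ hΔX,
      sub_sub_cancel]
    exact Int.natCast_dvd_natCast.mpr h4
  · rw [localEulerFactor_apply_prime _ _ (primesEquiv v).2, if_neg]
    rw [natCard_residueField_adicCompletionIntegers, ← Subtype.ext_iff]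
    exact fun h ↦ hw (primesEquiv.injective h)

end XiBoundFreyEisenstein

open IsDedekindDomain NumberField Literature.NumberTheory.EllipticCurves

/-- **The Frey form is Eisenstein mod `4` (trivial `ρ̄₂`).** For coprime `a, b` with
`ab(a+b) ≠ 0` and an odd prime `p ∤ ab(a+b)` (good reduction), `4 ∣ p + 1 − a_p(E_(a,b))`, where
`a_p` is the `p`-th coefficient of Mathlib's `WeierstrassCurve.LFunction` of the Frey curve
`y² = x(x − a)(x + b)`: `a_p = p + 1 − #Ẽ(𝔽_p)` on the (here `p`-minimal) Frey model, and the
rational `2`-torsion points `O, (0,0), (a,0), (−b,0)` reduce to a Klein four subgroup of `Ẽ(𝔽_p)`. -/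
theorem stub_freyEisensteinModFour :
    ∀ a b : ℤ, IsCoprime a b → a * b * (a + b) ≠ 0 → ∀ p : ℕ, p.Prime → p ≠ 2 →
      ¬ (p : ℤ) ∣ a * b * (a + b) → (4 : ℤ) ∣ (p : ℤ) + 1 - (freyCurve a b).LFunction p := by
  intro a b _ _ p hp hp2 hdiv
  obtain ⟨v, rfl⟩ : ∃ v : HeightOneSpectrum (𝓞 ℚ), (Rat.HeightOneSpectrum.primesEquiv v : ℕ) = p :=
    ⟨Rat.HeightOneSpectrum.primesEquiv.symm ⟨p, hp⟩, by rw [Equiv.apply_symm_apply]⟩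
  exact XiBoundFreyEisenstein.four_dvd_prime_add_one_sub_lFunction a b v hp2 hdiv

end Summit.ABC.ABC.Theorems

end
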